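import Summits.HodgeConjecture.CorCM.IrreducibleOddWeightsIsotypicMultiplicity
import Summits.HodgeConjecture.CorCM.IrreducibleOddWeightsIsotypicSplittingCMFields
import HarnessLib

/-!
# Isotypic cells, X (type ranks and CM fields): THE EXACT DEFECT INSIDE AN ABSOLUTELY IRREDUCIBLE CLASS —
# `dim Hg(A₀)+dim Hg(A₁)−dim Hg(A₀×A₁) = (rank b + rank b′ − rank(b ⊔ b′)) · d`

COR-CM (cell `pub-hodgecm2`, binder seat `b16` gen 70, count-neutral claim ISOTYPIC SPLITTING OF THE DEFECT, file I10 —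
type ranks and CM fields; theorems only, no definition, no named fact, no `sorry`).  NEW as stated, hence under
`Summits/`.  HONEST FRAMING: file I9's multiplicity formula read through gen 68's two-pivot shadow formula; Galois theory
of CM fields inside `ℂ` and linear algebra of odd weights, with consequences for `dim MT(A₀ × A₁)` of abelian varieties
with complex multiplication (Kubota–Dodson rank = `dim MT`, Pohlmann); nothing is claimed about the algebraicity of Hodge
classes; `HC_CM` is neither used nor asserted.

SETTING.  Two slots with pivots refining the trace classes (abstract: `r_κ : E_κ → Y_κ`; CM: subfields `T_κ ⊆ K_{i_κ}`
with (TR)); BOTH shadows lie in ONE isotypic class built from a reference stable irreducible `A ≤ ℚ^{Y}` with SCALAR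
COMMUTANT by equivariant, jointly independent embeddings `ι⁰_j : ℚ^{Y} → ℚ^{Y₀}`, `ι¹_k : ℚ^{Y} → ℚ^{Y₁}`:
`w₀ = Σ_j ι⁰_j(b_j)`, `w₁ = Σ_k ι¹_k(b′_k)`, `b, b′` tuples in `A`, `d = dim A`.

* **`typeRank_add_typeRank_add_rank_mul_eq_of_class`**: `rank Φ₀ + rank Φ₁ + rank(b ⊔ b′)·d = rank(Φ₀,Φ₁) + 1 +
  (rank b + rank b′)·d`, i.e. **the defect is `(rank b + rank b′ − rank(b ⊔ b′))·d`, the number of independent linear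
  relations between the components of the two shadows, times `d`**.
* **`cmTypeRank_add_cmTypeRank_add_rank_mul_eq_of_class`** — the same for CM types:
  `cmTypeRank Φ₀ + cmTypeRank Φ₁ + rank(b ⊔ b′)·d = cmFamilyRank Φ + 1 + (rank b + rank b′)·d`.
  One constituent per side (`J₀ = J₁ = pt`): the defect is `d` when `b′ ∥ b` and `0` otherwise (gen 69 Q3/Q4, Q9's
  parity certificate decides parallelism for the 46 dyadic bases); Galois pivots `T = L`, where `Anti(L) = ℚ[G]⁻` carries
  every odd irreducible `V` with multiplicity `dim V` (absolutely irreducible case), are the natural home of `|J| ≥ 2`.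
For a general pair, cut first (files I4/I6/I7) and apply this class by class.

## References

* [Gordon1999HodgeAVSurvey] B. B. Gordon, *A survey of the Hodge conjecture for abelian varieties*, §3 Theorem (Imai,
  Murty) with proof, 7.5–7.7, 9.4.3.
* [Lang2002] S. Lang, *Algebra*, 3rd ed., XVII §3.
* [Serre1977] J.-P. Serre, *Linear Representations of Finite Groups*, GTM 42, §2.6.
* [Deligne1982HodgeCycles] P. Deligne, *Hodge cycles on abelian varieties*, LNM 900, I §3 Ex. 3.7.
-/

set_option autoImplicit false

noncomputable section

open scoped BigOperators Classical

universe u u₀ u₁ v v' v'' vY w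

namespace Summit.HodgeConjecture.CorCM.IrrOdd

open Literature.NumberTheory.ComplexMultiplication

variable {G : Type w} [Group G] {Y : Type vY} [MulAction G Y] [Fintype Y]
  {Y₀ : Type v'} [MulAction G Y₀] [Fintype Y₀] {Y₁ : Type v''} [MulAction G Y₁] [Fintype Y₁]
  {I : Type u} {E : I → Type v} [∀ i, MulAction G (E i)] [∀ i, Fintype (E i)] [Fintype I] [∀ i, Nonempty (E i)]

/-- **THE EXACT DEFECT INSIDE AN ABSOLUTELY IRREDUCIBLE CLASS (type ranks).**  Two slots with equivariant pivots
refining the trace classes; both shadows assembled from a reference stable irreducible `A` with scalar commutant by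
equivariant, jointly independent embeddings: `w₀ = Σ_j ι⁰_j(b_j)`, `w₁ = Σ_k ι¹_k(b′_k)`.  Then
`rank Φ₀ + rank Φ₁ + rank(b ⊔ b′)·dim A = rank(Φ₀,Φ₁) + 1 + (rank b + rank b′)·dim A`.
[cite: Gordon1999HodgeAVSurvey, §3 Theorem, 7.5–7.7 and 9.4.3] [cite: Lang2002, XVII §3] -/
theorem typeRank_add_typeRank_add_rank_mul_eq_of_class {ρ : G} {Φ : ∀ i, Set (E i)}
    (h : ∀ i, IsCMTypeWith ρ (Φ i)) {i₀ i₁ : I} (hI : ∀ j, j = i₀ ∨ j = i₁) (h01 : i₀ ≠ i₁)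
    (r₀ : E i₀ → Y₀) (r₁ : E i₁ → Y₁) (hr₀ : ∀ (g : G) (x : E i₀), r₀ (g • x) = g • r₀ x)
    (hr₁ : ∀ (g : G) (x : E i₁), r₁ (g • x) = g • r₁ x)
    (hfine₀ : ∀ x x' : E i₀, r₀ x = r₀ x' → ∃ n : G, (∀ y : E i₁, n • y = y) ∧ n • x = x')
    (hfine₁ : ∀ x x' : E i₁, r₁ x = r₁ x' → ∃ n : G, (∀ y : E i₀, n • y = y) ∧ n • x = x')
    {A : Submodule ℚ (Y → ℚ)}
    (hAst : ∀ (k : G) (a : Y → ℚ), a ∈ A → (fun y => a (k • y)) ∈ A)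
    (hAirr : ∀ W : Submodule ℚ (Y → ℚ), W ≤ A → W ≠ ⊥ →
      (∀ (k : G) (f : Y → ℚ), f ∈ W → (fun y => f (k • y)) ∈ W) → W = A)
    (hsc : ∀ L : (Y → ℚ) →ₗ[ℚ] (Y → ℚ), (∀ a ∈ A, L a ∈ A) →
      (∀ (k : G) (a : Y → ℚ), a ∈ A → L (fun y => a (k • y)) = fun y => L a (k • y)) → ∃ c : ℚ, ∀ a ∈ A, L a = c • a)
    {J₀ : Type u₀} {J₁ : Type u₁} [Fintype J₀] [Fintype J₁]
    (ι₀ : J₀ → ((Y → ℚ) →ₗ[ℚ] (Y₀ → ℚ))) (ι₁ : J₁ → ((Y → ℚ) →ₗ[ℚ] (Y₁ → ℚ)))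
    (hι₀eq : ∀ (j : J₀) (k : G) (a : Y → ℚ), a ∈ A → ι₀ j (fun y => a (k • y)) = fun y => ι₀ j a (k • y))
    (hι₁eq : ∀ (j : J₁) (k : G) (a : Y → ℚ), a ∈ A → ι₁ j (fun y => a (k • y)) = fun y => ι₁ j a (k • y))
    (hind₀ : ∀ f : J₀ → (Y → ℚ), (∀ j, f j ∈ A) → ∑ j, ι₀ j (f j) = 0 → ∀ j, f j = 0)
    (hind₁ : ∀ f : J₁ → (Y → ℚ), (∀ j, f j ∈ A) → ∑ j, ι₁ j (f j) = 0 → ∀ j, f j = 0)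
    {b₀ : J₀ → (Y → ℚ)} {b₁ : J₁ → (Y → ℚ)} (hb₀ : ∀ j, b₀ j ∈ A) (hb₁ : ∀ j, b₁ j ∈ A)
    (hw₀ : (fun y : Y₀ => ∑ x ∈ Finset.univ.filter (fun x => r₀ x = y), antiVec (Φ i₀) (1 : G) x) =
      ∑ j, ι₀ j (b₀ j))
    (hw₁ : (fun y : Y₁ => ∑ x ∈ Finset.univ.filter (fun x => r₁ x = y), antiVec (Φ i₁) (1 : G) x) =
      ∑ j, ι₁ j (b₁ j)) :
    typeRank G (Φ i₀) + typeRank G (Φ i₁) +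
        Module.finrank ℚ ↥(Submodule.span ℚ (Set.range (Sum.elim b₀ b₁))) * Module.finrank ℚ A =
      typeRank G (sigmaType Φ) + 1 +
        (Module.finrank ℚ ↥(Submodule.span ℚ (Set.range b₀)) + Module.finrank ℚ ↥(Submodule.span ℚ (Set.range b₁))) *
          Module.finrank ℚ A := by
  have hpair := typeRank_add_typeRank_eq_add_finrank_shadowCoeff_inf_shadowCoeff_of_fine h hI h01 r₀ r₁ hr₀ hr₁
    hfine₀ hfine₁
  have e₀ : (fun (y : Y₀) (g : G) => ∑ x ∈ Finset.univ.filter (fun x => r₀ x = g • y), antiVec (Φ i₀) (1 : G) x) =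
      fun (y : Y₀) (g : G) => (∑ j, ι₀ j (b₀ j)) (g • y) := by
    funext y g
    exact congrFun hw₀ (g • y)
  have e₁ : (fun (y : Y₁) (g : G) => ∑ x ∈ Finset.univ.filter (fun x => r₁ x = g • y), antiVec (Φ i₁) (1 : G) x) =
      fun (y : Y₁) (g : G) => (∑ j, ι₁ j (b₁ j)) (g • y) := by
    funext y g
    exact congrFun hw₁ (g • y)
  rw [e₀, e₁] at hpair
  have hcls := finrank_span_shadowCoeff_inf_add_rank_mul_eq hAst hAirr hsc ι₀ ι₁ hι₀eq hι₁eq hind₀ hind₁ hb₀ hb₁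
  omega

end Summit.HodgeConjecture.CorCM.IrrOdd

namespace Summit.HodgeConjecture.CorCM

open CategoryTheory CategoryTheory.Limits NumberField Module IntermediateField
open Literature.NumberTheory.ComplexMultiplication
open Literature.AlgebraicGeometry.Motives (AbelianVariety CMType)
open Literature.AlgebraicGeometry.Motives.AbelianVariety
open Literature.AlgebraicGeometry.HodgeTheory
open Literature.AlgebraicGeometry.ComplexMultiplication (IsCMTypeRealisation)
open Literature.AlgebraicGeometry.Pohlmann1968

variable {I : Type} [Fintype I] {K : I → Type} [∀ i, Field (K i)] [∀ i, NumberField (K i)] [∀ i, IsCMField (K i)]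
  {T₀ : Type} [Field T₀] [NumberField T₀] {T₁ : Type} [Field T₁] [NumberField T₁]
  {Y : Type vY} [MulAction (ℂ ≃+* ℂ) Y] [Fintype Y]

/-- **THE EXACT DEFECT INSIDE AN ABSOLUTELY IRREDUCIBLE CLASS (CM fields).**  `T₀ ⊆ K_{i₀}`, `T₁ ⊆ K_{i₁}` subfields
containing the traces (TR); both shadows `w_κ` on `Hom(T_κ, ℂ)` assembled from a reference `Aut(ℂ)`-stable irreducible
`A ≤ ℚ^{Y}` with SCALAR COMMUTANT by equivariant, jointly independent embeddings `ι⁰_j`, `ι¹_k`: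
`w₀ = Σ_j ι⁰_j(b_j)`, `w₁ = Σ_k ι¹_k(b′_k)`.  Then
**`cmTypeRank Φ₀ + cmTypeRank Φ₁ + rank(b ⊔ b′)·dim A = cmFamilyRank Φ + 1 + (rank b + rank b′)·dim A`** — the defect
`dim Hg(A₀)+dim Hg(A₁)−dim Hg(A₀×A₁)` equals `(rank b + rank b′ − rank(b ⊔ b′))·dim A`.
[cite: Gordon1999HodgeAVSurvey, §3 Theorem, 7.5–7.7 and 9.4.3] [cite: Lang2002, XVII §3] [cite: Serre1977, §2.6] -/
theorem cmTypeRank_add_cmTypeRank_add_rank_mul_eq_of_class {i₀ i₁ : I} (h01 : i₀ ≠ i₁) (hI : ∀ l, l = i₀ ∨ l = i₁)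
    (Φ : ∀ i, CMType (K i)) [Algebra T₀ (K i₀)] [Algebra T₁ (K i₁)]
    (htr₀ : ∀ (a : K i₀ →+* ℂ) (k : K i₀), a k ∈ normalClosure ℚ (K i₁) ℂ → k ∈ Set.range (algebraMap T₀ (K i₀)))
    (htr₁ : ∀ (b : K i₁ →+* ℂ) (k : K i₁), b k ∈ normalClosure ℚ (K i₀) ℂ → k ∈ Set.range (algebraMap T₁ (K i₁)))
    {A : Submodule ℚ (Y → ℚ)}
    (hAst : ∀ (k : ℂ ≃+* ℂ) (a : Y → ℚ), a ∈ A → (fun y => a (k • y)) ∈ A)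
    (hAirr : ∀ W : Submodule ℚ (Y → ℚ), W ≤ A → W ≠ ⊥ →
      (∀ (k : ℂ ≃+* ℂ) (f : Y → ℚ), f ∈ W → (fun y => f (k • y)) ∈ W) → W = A)
    (hsc : ∀ L : (Y → ℚ) →ₗ[ℚ] (Y → ℚ), (∀ a ∈ A, L a ∈ A) →
      (∀ (k : ℂ ≃+* ℂ) (a : Y → ℚ), a ∈ A → L (fun y => a (k • y)) = fun y => L a (k • y)) →
        ∃ c : ℚ, ∀ a ∈ A, L a = c • a)
    {J₀ J₁ : Type} [Fintype J₀] [Fintype J₁]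
    (ι₀ : J₀ → ((Y → ℚ) →ₗ[ℚ] ((T₀ →+* ℂ) → ℚ))) (ι₁ : J₁ → ((Y → ℚ) →ₗ[ℚ] ((T₁ →+* ℂ) → ℚ)))
    (hι₀eq : ∀ (j : J₀) (k : ℂ ≃+* ℂ) (a : Y → ℚ), a ∈ A → ι₀ j (fun y => a (k • y)) = fun y => ι₀ j a (k • y))
    (hι₁eq : ∀ (j : J₁) (k : ℂ ≃+* ℂ) (a : Y → ℚ), a ∈ A → ι₁ j (fun y => a (k • y)) = fun y => ι₁ j a (k • y))
    (hind₀ : ∀ f : J₀ → (Y → ℚ), (∀ j, f j ∈ A) → ∑ j, ι₀ j (f j) = 0 → ∀ j, f j = 0)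
    (hind₁ : ∀ f : J₁ → (Y → ℚ), (∀ j, f j ∈ A) → ∑ j, ι₁ j (f j) = 0 → ∀ j, f j = 0)
    {b₀ : J₀ → (Y → ℚ)} {b₁ : J₁ → (Y → ℚ)} (hb₀ : ∀ j, b₀ j ∈ A) (hb₁ : ∀ j, b₁ j ∈ A)
    (hw₀ : (fun y : T₀ →+* ℂ => ∑ t ∈ Finset.univ.filter (fun t : K i₀ →+* ℂ => t.comp (algebraMap T₀ (K i₀)) = y),
        antiVec (Φ i₀).1 (1 : ℂ ≃+* ℂ) t) = ∑ j, ι₀ j (b₀ j))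
    (hw₁ : (fun y : T₁ →+* ℂ => ∑ t ∈ Finset.univ.filter (fun t : K i₁ →+* ℂ => t.comp (algebraMap T₁ (K i₁)) = y),
        antiVec (Φ i₁).1 (1 : ℂ ≃+* ℂ) t) = ∑ j, ι₁ j (b₁ j)) :
    cmTypeRank (Φ i₀) + cmTypeRank (Φ i₁) +
        Module.finrank ℚ ↥(Submodule.span ℚ (Set.range (Sum.elim b₀ b₁))) * Module.finrank ℚ A =
      CMAlgebra.cmFamilyRank Φ + 1 +
        (Module.finrank ℚ ↥(Submodule.span ℚ (Set.range b₀)) + Module.finrank ℚ ↥(Submodule.span ℚ (Set.range b₁))) *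
          Module.finrank ℚ A := by
  haveI : ∀ i, Nonempty (K i →+* ℂ) := fun i => inferInstance
  exact IrrOdd.typeRank_add_typeRank_add_rank_mul_eq_of_class (G := ℂ ≃+* ℂ) (E := fun i => K i →+* ℂ)
    (Φ := fun i => (Φ i).1) (fun i => isCMTypeWith_conj (Φ i)) hI h01
    (fun t : K i₀ →+* ℂ => t.comp (algebraMap T₀ (K i₀))) (fun t : K i₁ →+* ℂ => t.comp (algebraMap T₁ (K i₁)))
    (fun _ _ => rfl) (fun _ _ => rfl) (exists_stab_smul_eq_of_comp_eq_of_trace_le i₁ htr₀)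
    (exists_stab_smul_eq_of_comp_eq_of_trace_le i₀ htr₁) hAst hAirr hsc ι₀ ι₁ hι₀eq hι₁eq hind₀ hind₁ hb₀ hb₁ hw₀ hw₁

end Summit.HodgeConjecture.CorCM

end
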